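import Summits.HodgeConjecture.HodgeConjecture.Theorems.Ring2WeilCoverageCMFieldDegreeOnePrimes
import HarnessLib

/-!
# Non-split Weil-type components over quartic CM fields, III (criteria): the three divisibility steps at a
# principal degree-one prime `π = t + σ` of `F` — ramified unit classes, ramified classes `[ℓw]`, inert `[ℓw]`

research route conditional on HC_CM; not a corollary; Q11.4-sentence-2 already refuted in dim ≥ 3.
Cell `pub-hodge-ring2`, seat `ring2-b03` (gen 48); kernel certificates for the Weil-type family-coverage census
`HOME/WEIL-FAMILY-COVERAGE.md` §b03.5 (operator priority5 2026-08-22T11:46:08Z). Companion of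
`Ring2WeilCoverageCMFieldDegreeOnePrimes.lean` (same gen), whose engine `normSq_eq_zero_of_dvd_step` /
certificate `mk_ne_splitDiscriminantClassCM_of_dvd_step` decides `[n] ≠ [1]` in `F^×/Nm_{E/F}(E^×)`
(`R = S² + pS + q`, Deligne's carriers `Deligne1982/WeilTypeCMDiscriminant`) from ONE hypothesis `hdiv`: every
solution of `x² - σy² = n·m²` in `ℤ[σ]` is `≡ 0` modulo `π = t + σ`, `Nm π = t² - pt + q = ℓ` prime. Here:

* §1 three suppliers of `hdiv`, each from two `𝔽_ℓ`-facts decidable per instance (`ℓ.Prime` is an explicit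
  hypothesis, not a `Fact` instance, so that call sites can `decide` them):
  (R1) `dvd_step_of_ramified_nonsq` — `t = 0`, `q = ℓ` (`σ` itself generates the prime; `E = F(√σ)` RAMIFIES
  there), `n` a NON-SQUARE mod `ℓ` (`(n, σ)_{(σ)} = -1` for a `(σ)`-unit `n`);
  (R2) `dvd_step_of_ramified_mul` — `t = 0`, `q = ℓ`, `n = ℓw` with `p·w` a non-square mod `ℓ` (the leading
  coefficient `-σ̄ w ≡ p w (mod σ)`);
  (H) `dvd_step_of_inert_degreeOne` — `(π)` INERT in `E/F` (`-t ≡ σ` a non-square mod `ℓ`), `ℓ` unramified in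
  `F` (`2t - p ≢ 0`), `n = ℓw`, `ℓ ∤ w` (`v_π(n) = 1` odd): the «half-split» primes of a NON-GALOIS `E`, where
  the conjugate place `(π̄)` may split in `E/F` and the integer-coordinate criteria of gens 46–47 are silent.
* §2 the packaged certificates `mk_ne_splitDiscriminantClassCM_of_ramified_nonsq`,
  `mk_prime_mul_ne_splitDiscriminantClassCM_of_ramified`, `mk_prime_mul_ne_splitDiscriminantClassCM_of_inert_degreeOne`
  (CM regime `0 < p`, `4q < p²`, `p² - 4q` not a rational square, so both carriers are fields by factor exclusion,
  `Ring2WeilCoverageCMFieldCriteria`): `[n] ≠ [(-1)²] = [1]` — the Weil-type component `(E, 4, [n])` has no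
  `E`-Lagrangian member (Deligne Cor. 4.2). Instances for `E = ℚ(√-(3+√2))` (the `14` classes of the census
  table left to computation by gens 46–47) in `Ring2WeilCoverageCMFieldNonGalois.lean`.

No named fact, no definition, no `sorry`; nothing about the Hodge conjecture is asserted.
References: [Deligne1982HodgeCycles] §4 p. 30 (1), Cor. 4.2, Lemma 4.6; [Landherr1936HermitianForms]. -/

noncomputable section

set_option linter.dupNamespace false

open Polynomial

namespace Summit.HodgeConjecture.HodgeConjecture.Ring2.WeilCoverageCM

open Literature.AlgebraicGeometry.Deligne1982
open Literature.AlgebraicGeometry.HodgeTheory (splitDiscriminantClassCM)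

/-! ### §1 Three suppliers of the divisibility step `hdiv` -/

/-- **(R1) The ramified degree-one prime `π = σ` (`t = 0`, `q = ℓ`), unit classes.** If `q = ℓ` is prime
(`σ` generates a prime of `F` of norm `ℓ`, at which `E = F(√σ)` ramifies) and `n` is a NON-SQUARE mod `ℓ`
(`(n, σ)_{(σ)} = -1`), then every solution of `x² - σy² = n·m²` has `x ≡ y ≡ m ≡ 0 (mod σ)`:
`X ≡ A² ≡ nM₀² (ℓ)` gives `ℓ ∣ M₀, A`; then the constant coefficient of `(x² - σy² - nm²)/σ` gives `C² ≡ 0`.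
[folklore] -/
theorem dvd_step_of_ramified_nonsq (p : ℤ) (ℓ : ℕ) (hℓ : ℓ.Prime) (n : ℤ)
    (hn : ∀ s : ZMod ℓ, s ^ 2 ≠ (n : ZMod ℓ)) :
    ∀ A B C D M₀ M₁ : ℤ,
      A ^ 2 - (ℓ : ℤ) * B ^ 2 + 2 * (ℓ : ℤ) * C * D - p * (ℓ : ℤ) * D ^ 2 = n * (M₀ ^ 2 - (ℓ : ℤ) * M₁ ^ 2) →
      2 * A * B - p * B ^ 2 - C ^ 2 + 2 * p * C * D - (p ^ 2 - (ℓ : ℤ)) * D ^ 2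
          = n * (2 * M₀ * M₁ - p * M₁ ^ 2) →
        (ℓ : ℤ) ∣ A - 0 * B ∧ (ℓ : ℤ) ∣ C - 0 * D ∧ (ℓ : ℤ) ∣ M₀ - 0 * M₁ := by
  haveI : Fact ℓ.Prime := ⟨hℓ⟩
  have hℓp : Prime (ℓ : ℤ) := Nat.prime_iff_prime_int.1 hℓ
  have hℓ0 : (ℓ : ℤ) ≠ 0 := hℓp.ne_zero
  have hz : ((ℓ : ℕ) : ZMod ℓ) = 0 := ZMod.natCast_self ℓ
  have sq_zero : ∀ x : ZMod ℓ, x ^ 2 = 0 → x = 0 := fun x hx => pow_eq_zero_iff (n := 2) (by norm_num) |>.1 hx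
  intro A B C D M₀ M₁ hX hY
  -- (i) `A² ≡ n M₀²`, so `ℓ ∣ M₀` (else `n` is a square) and `ℓ ∣ A`
  have h1 : ((A : ZMod ℓ)) ^ 2 = (n : ZMod ℓ) * (M₀ : ZMod ℓ) ^ 2 := by
    have := congrArg (Int.cast : ℤ → ZMod ℓ) hX
    push_cast at this
    linear_combination this + ((B : ZMod ℓ) ^ 2 - 2 * (C : ZMod ℓ) * (D : ZMod ℓ) + (p : ZMod ℓ) * (D : ZMod ℓ) ^ 2
      - (n : ZMod ℓ) * (M₁ : ZMod ℓ) ^ 2) * hz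
  have hM : ((M₀ : ZMod ℓ)) = 0 := by
    by_contra hM
    refine hn ((A : ZMod ℓ) / (M₀ : ZMod ℓ)) ?_
    field_simp
    linear_combination h1
  have hA : ((A : ZMod ℓ)) = 0 := by
    refine sq_zero _ ?_
    rw [h1, hM]; ring
  rw [ZMod.intCast_zmod_eq_zero_iff_dvd] at hA hM
  obtain ⟨⟨a, rfl⟩, ⟨μ, rfl⟩⟩ := And.intro hA hM
  -- (ii) the constant coefficient of `(x² - σy² - n m²)/σ`: `C² = ℓ·G`
  have h2 : (ℓ : ℤ) * (C ^ 2 - (ℓ : ℤ) * (D ^ 2 - (2 * (B - p * a) * (-a) - p * (-a) ^ 2)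
      + n * (2 * (M₁ - p * μ) * (-μ) - p * (-μ) ^ 2))) = 0 := by
    linear_combination p * hX - (ℓ : ℤ) * hY
  have hC : (ℓ : ℤ) ∣ C := by
    have h3 : C ^ 2 = (ℓ : ℤ) * (D ^ 2 - (2 * (B - p * a) * (-a) - p * (-a) ^ 2)
        + n * (2 * (M₁ - p * μ) * (-μ) - p * (-μ) ^ 2)) := by
      linear_combination (mul_eq_zero.1 h2).resolve_left hℓ0
    exact hℓp.dvd_of_dvd_pow (n := 2) ⟨_, h3⟩
  refine ⟨?_, ?_, ?_⟩
  · rw [zero_mul, sub_zero]; exact ⟨a, rfl⟩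
  · rwa [zero_mul, sub_zero]
  · rw [zero_mul, sub_zero]; exact ⟨μ, rfl⟩

/-- **(R2) The ramified degree-one prime `π = σ` (`t = 0`, `q = ℓ`), classes `[ℓw]`.** If `q = ℓ` is prime and
`p·w` is a NON-SQUARE mod `ℓ` (the leading coefficient `-σ̄ w ≡ p w (mod σ)`; in particular `ℓ ∤ p`, `ℓ ∤ w`),
then every solution of `x² - σy² = ℓw·m²` has `x ≡ y ≡ m ≡ 0 (mod σ)`: `X ≡ A² ≡ 0 (ℓ)` gives `ℓ ∣ A`; the
constant coefficient of `(x² - σy² - ℓw m²)/σ` gives `C² ≡ pwM₀² (ℓ)`, whence `ℓ ∣ M₀, C`. [folklore] -/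
theorem dvd_step_of_ramified_mul (p : ℤ) (ℓ : ℕ) (hℓ : ℓ.Prime) (w : ℤ)
    (hw : ∀ s : ZMod ℓ, s ^ 2 ≠ (p : ZMod ℓ) * (w : ZMod ℓ)) :
    ∀ A B C D M₀ M₁ : ℤ,
      A ^ 2 - (ℓ : ℤ) * B ^ 2 + 2 * (ℓ : ℤ) * C * D - p * (ℓ : ℤ) * D ^ 2
          = (ℓ : ℤ) * w * (M₀ ^ 2 - (ℓ : ℤ) * M₁ ^ 2) →
      2 * A * B - p * B ^ 2 - C ^ 2 + 2 * p * C * D - (p ^ 2 - (ℓ : ℤ)) * D ^ 2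
          = (ℓ : ℤ) * w * (2 * M₀ * M₁ - p * M₁ ^ 2) →
        (ℓ : ℤ) ∣ A - 0 * B ∧ (ℓ : ℤ) ∣ C - 0 * D ∧ (ℓ : ℤ) ∣ M₀ - 0 * M₁ := by
  haveI : Fact ℓ.Prime := ⟨hℓ⟩
  have hℓp : Prime (ℓ : ℤ) := Nat.prime_iff_prime_int.1 hℓ
  have hℓ0 : (ℓ : ℤ) ≠ 0 := hℓp.ne_zero
  have hz : ((ℓ : ℕ) : ZMod ℓ) = 0 := ZMod.natCast_self ℓ
  have sq_zero : ∀ x : ZMod ℓ, x ^ 2 = 0 → x = 0 := fun x hx => pow_eq_zero_iff (n := 2) (by norm_num) |>.1 hx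
  intro A B C D M₀ M₁ hX hY
  -- (i) `A² ≡ 0`, so `ℓ ∣ A`
  have hA : ((A : ZMod ℓ)) = 0 := by
    refine sq_zero _ ?_
    have := congrArg (Int.cast : ℤ → ZMod ℓ) hX
    push_cast at this
    linear_combination this + ((B : ZMod ℓ) ^ 2 - 2 * (C : ZMod ℓ) * (D : ZMod ℓ) + (p : ZMod ℓ) * (D : ZMod ℓ) ^ 2
      + (w : ZMod ℓ) * ((M₀ : ZMod ℓ) ^ 2 - ((ℓ : ℕ) : ZMod ℓ) * (M₁ : ZMod ℓ) ^ 2)) * hz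
  rw [ZMod.intCast_zmod_eq_zero_iff_dvd] at hA
  obtain ⟨a, rfl⟩ := hA
  -- (ii) the constant coefficient of `(x² - σy² - ℓw m²)/σ`: `C² - pwM₀² = ℓ·G`
  have h2 : (ℓ : ℤ) * (C ^ 2 - p * w * M₀ ^ 2 - (ℓ : ℤ) * (-(2 * (B - p * a) * (-a) - p * (-a) ^ 2) + D ^ 2
      - w * p * M₁ ^ 2 - w * (2 * M₀ * M₁ - p * M₁ ^ 2))) = 0 := by
    linear_combination p * hX - (ℓ : ℤ) * hY
  have h3 : ((C : ZMod ℓ)) ^ 2 = (p : ZMod ℓ) * (w : ZMod ℓ) * (M₀ : ZMod ℓ) ^ 2 := by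
    have h4 : C ^ 2 - p * w * M₀ ^ 2 = (ℓ : ℤ) * (-(2 * (B - p * a) * (-a) - p * (-a) ^ 2) + D ^ 2
        - w * p * M₁ ^ 2 - w * (2 * M₀ * M₁ - p * M₁ ^ 2)) := by
      linear_combination (mul_eq_zero.1 h2).resolve_left hℓ0
    have := congrArg (Int.cast : ℤ → ZMod ℓ) h4
    push_cast at this
    linear_combination this + (-(2 * ((B : ZMod ℓ) - (p : ZMod ℓ) * (a : ZMod ℓ)) * (-(a : ZMod ℓ))
      - (p : ZMod ℓ) * (-(a : ZMod ℓ)) ^ 2) + (D : ZMod ℓ) ^ 2 - (w : ZMod ℓ) * (p : ZMod ℓ) * (M₁ : ZMod ℓ) ^ 2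
      - (w : ZMod ℓ) * (2 * (M₀ : ZMod ℓ) * (M₁ : ZMod ℓ) - (p : ZMod ℓ) * (M₁ : ZMod ℓ) ^ 2)) * hz
  have hM : ((M₀ : ZMod ℓ)) = 0 := by
    by_contra hM
    refine hw ((C : ZMod ℓ) / (M₀ : ZMod ℓ)) ?_
    field_simp
    linear_combination h3
  have hC : ((C : ZMod ℓ)) = 0 := by
    refine sq_zero _ ?_
    rw [h3, hM]; ring
  rw [ZMod.intCast_zmod_eq_zero_iff_dvd] at hM hC
  refine ⟨?_, ?_, ?_⟩
  · rw [zero_mul, sub_zero]; exact ⟨a, rfl⟩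
  · rwa [zero_mul, sub_zero]
  · rwa [zero_mul, sub_zero]

/-- **(H) A degree-one prime `π = t + σ`, `Nm π = ℓ`, INERT in `E/F`, classes `[ℓw]`, `ℓ ∤ w`.** If `-t ≡ σ` is a
NON-SQUARE mod `ℓ` (the place `(π)` is inert in `E = F(√σ)`), `2t - p ≢ 0 (mod ℓ)` (`π̄ ∉ (π)`: `ℓ` splits in
`F`) and `ℓ ∤ w` (`v_π(ℓw) = 1` is odd), then every solution of `x² - σy² = ℓw·m²` has
`x ≡ y ≡ m ≡ 0 (mod π)`: reducing mod `π` (`σ ↦ -t`), `x̄² + t ȳ² = 0` forces `x̄ = ȳ = 0` (anisotropy); then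
`x = πx₁`, `y = πy₁` and `π(x₁² - σy₁²) = π̄ w m²` reduces to `(2t - p) w m̄² = 0`. Nothing is required at the
conjugate place `(π̄)`, which may split in `E/F` (non-Galois `E`). [folklore] -/
theorem dvd_step_of_inert_degreeOne (p q t : ℤ) (ℓ : ℕ) (hℓ : ℓ.Prime) (hL : t ^ 2 - p * t + q = ℓ)
    (ht : ∀ s : ZMod ℓ, s ^ 2 ≠ -(t : ZMod ℓ)) (h2t : 2 * (t : ZMod ℓ) - (p : ZMod ℓ) ≠ 0)
    (w : ℤ) (hw : ¬ (ℓ : ℤ) ∣ w) :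
    ∀ A B C D M₀ M₁ : ℤ,
      A ^ 2 - q * B ^ 2 + 2 * q * C * D - p * q * D ^ 2 = (ℓ : ℤ) * w * (M₀ ^ 2 - q * M₁ ^ 2) →
      2 * A * B - p * B ^ 2 - C ^ 2 + 2 * p * C * D - (p ^ 2 - q) * D ^ 2
          = (ℓ : ℤ) * w * (2 * M₀ * M₁ - p * M₁ ^ 2) →
        (ℓ : ℤ) ∣ A - t * B ∧ (ℓ : ℤ) ∣ C - t * D ∧ (ℓ : ℤ) ∣ M₀ - t * M₁ := by
  haveI : Fact ℓ.Prime := ⟨hℓ⟩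
  have hℓp : Prime (ℓ : ℤ) := Nat.prime_iff_prime_int.1 hℓ
  have hℓ0 : (ℓ : ℤ) ≠ 0 := hℓp.ne_zero
  have hz : ((ℓ : ℕ) : ZMod ℓ) = 0 := ZMod.natCast_self ℓ
  have hLz : (t : ZMod ℓ) ^ 2 - (p : ZMod ℓ) * (t : ZMod ℓ) + (q : ZMod ℓ) = 0 := by
    have := congrArg (Int.cast : ℤ → ZMod ℓ) hL
    push_cast at this
    rw [this, hz]
  have hwz : ((w : ZMod ℓ)) ≠ 0 := by rwa [Ne, ZMod.intCast_zmod_eq_zero_iff_dvd]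
  have sq_zero : ∀ x : ZMod ℓ, x ^ 2 = 0 → x = 0 := fun x hx => pow_eq_zero_iff (n := 2) (by norm_num) |>.1 hx
  intro A B C D M₀ M₁ hX hY
  -- (i) reduction mod `π`: `(A - tB)² + t(C - tD)² ≡ 0`
  have h1 : (A - t * B) ^ 2 + t * (C - t * D) ^ 2 - (ℓ : ℤ) * w * (M₀ - t * M₁) ^ 2
      + (t ^ 2 - p * t + q) * (-B ^ 2 + 2 * C * D - (t + p) * D ^ 2 + (ℓ : ℤ) * w * M₁ ^ 2) = 0 := by
    linear_combination hX - t * hY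
  have hφ : ((A : ZMod ℓ) - (t : ZMod ℓ) * (B : ZMod ℓ)) ^ 2
      + (t : ZMod ℓ) * ((C : ZMod ℓ) - (t : ZMod ℓ) * (D : ZMod ℓ)) ^ 2 = 0 := by
    have := congrArg (Int.cast : ℤ → ZMod ℓ) h1
    push_cast at this
    linear_combination this + ((w : ZMod ℓ) * ((M₀ : ZMod ℓ) - (t : ZMod ℓ) * (M₁ : ZMod ℓ)) ^ 2
        - (-(B : ZMod ℓ) ^ 2 + 2 * (C : ZMod ℓ) * (D : ZMod ℓ) - ((t : ZMod ℓ) + (p : ZMod ℓ)) * (D : ZMod ℓ) ^ 2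
          + ((ℓ : ℕ) : ZMod ℓ) * (w : ZMod ℓ) * (M₁ : ZMod ℓ) ^ 2) * 0) * hz
      - (-(B : ZMod ℓ) ^ 2 + 2 * (C : ZMod ℓ) * (D : ZMod ℓ) - ((t : ZMod ℓ) + (p : ZMod ℓ)) * (D : ZMod ℓ) ^ 2
          + ((ℓ : ℕ) : ZMod ℓ) * (w : ZMod ℓ) * (M₁ : ZMod ℓ) ^ 2) * hLz
  -- anisotropy: `-t` is a non-square
  have hv : ((C : ZMod ℓ) - (t : ZMod ℓ) * (D : ZMod ℓ)) = 0 := by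
    by_contra hv
    refine ht (((A : ZMod ℓ) - (t : ZMod ℓ) * (B : ZMod ℓ)) / ((C : ZMod ℓ) - (t : ZMod ℓ) * (D : ZMod ℓ))) ?_
    field_simp
    linear_combination hφ
  have hu : ((A : ZMod ℓ) - (t : ZMod ℓ) * (B : ZMod ℓ)) = 0 := by
    refine sq_zero _ ?_
    linear_combination hφ - (t : ZMod ℓ) * ((C : ZMod ℓ) - (t : ZMod ℓ) * (D : ZMod ℓ)) * hv
  have hu' : ((A - t * B : ℤ) : ZMod ℓ) = 0 := by push_cast; exact hu
  have hv' : ((C - t * D : ℤ) : ZMod ℓ) = 0 := by push_cast; exact hv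
  rw [ZMod.intCast_zmod_eq_zero_iff_dvd] at hu' hv'
  refine ⟨hu', hv', ?_⟩
  obtain ⟨a, ha⟩ := hu'
  obtain ⟨c, hc⟩ := hv'
  have hA : A = t * B + (t ^ 2 - p * t + q) * a := by rw [hL]; linear_combination ha
  have hC : C = t * D + (t ^ 2 - p * t + q) * c := by rw [hL]; linear_combination hc
  subst hA hC
  rw [← hL] at hX hY
  -- (ii) `x = πx₁`, `y = πy₁`; the reduction mod `π` of `π(x₁² - σy₁²) - π̄ w m² = 0` is `(2t - p) w m̄² = 0`
  have h2 : (t ^ 2 - p * t + q) * ((2 * t - p) * w * (M₀ - t * M₁) ^ 2 - (t ^ 2 - p * t + q) *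
      (-(2 * (B + a * (t - p)) * (-a) - p * (-a) ^ 2 - (D + c * (t - p)) ^ 2
          + 2 * p * (D + c * (t - p)) * (-c) - (p ^ 2 - q) * (-c) ^ 2)
        - 2 * w * (M₀ * M₁ - t * M₁ ^ 2))) = 0 := by
    linear_combination (-(2 * t - p)) * hX + (t ^ 2 - q) * hY
  have hL0 : (t ^ 2 - p * t + q : ℤ) ≠ 0 := by rw [hL]; exact hℓ0
  have h3 : (2 * t - p) * w * (M₀ - t * M₁) ^ 2 = (t ^ 2 - p * t + q) *
      (-(2 * (B + a * (t - p)) * (-a) - p * (-a) ^ 2 - (D + c * (t - p)) ^ 2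
          + 2 * p * (D + c * (t - p)) * (-c) - (p ^ 2 - q) * (-c) ^ 2)
        - 2 * w * (M₀ * M₁ - t * M₁ ^ 2)) := by
    linear_combination (mul_eq_zero.1 h2).resolve_left hL0
  have h4 : (2 * (t : ZMod ℓ) - (p : ZMod ℓ)) * (w : ZMod ℓ) * ((M₀ : ZMod ℓ) - (t : ZMod ℓ) * (M₁ : ZMod ℓ)) ^ 2
      = 0 := by
    have := congrArg (Int.cast : ℤ → ZMod ℓ) h3
    push_cast at this
    rw [this, hLz, zero_mul]
  have hm : ((M₀ : ZMod ℓ) - (t : ZMod ℓ) * (M₁ : ZMod ℓ)) = 0 := by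
    rcases mul_eq_zero.1 h4 with h5 | h5
    · rcases mul_eq_zero.1 h5 with h6 | h6
      · exact absurd h6 h2t
      · exact absurd h6 hwz
    · exact sq_zero _ h5
  have hm' : ((M₀ - t * M₁ : ℤ) : ZMod ℓ) = 0 := by push_cast; exact hm
  rwa [ZMod.intCast_zmod_eq_zero_iff_dvd] at hm'

/-! ### §2 The three packaged certificates -/

/-- **Non-split criterion at the ramified degree-one prime `(σ)`, unit classes.** For `R = S² + pS + q` in the CM
regime (`0 < p`, `4q < p²`, `p² - 4q` not a rational square) with `q = ℓ` PRIME and a rational integer `n` that is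
a non-square mod `ℓ`: `[n] ≠ [(-1)²] = [1]` in `F^×/Nm_{E/F}(E^×)`. (For `E = ℚ(√-(3+√2))`, `R = S² + 6S + 7`: the
census classes `[3]`, `[6]`, `[12]`, `[17]`, `[19]`, `[24]`, `[27]`, `[31]`, `[34]`, `[38]`, obstructed at the tame
ramified place `(3+√2)` of norm `7`.) [cite: Deligne1982HodgeCycles, §4 p. 30 (1) and Cor. 4.2]
[cite: Landherr1936HermitianForms] -/
theorem mk_ne_splitDiscriminantClassCM_of_ramified_nonsq {p q : ℤ} {R : Polynomial ℤ}
    (hR : R = X ^ 2 + C p * X + C q) [Fact (Irreducible (realPolyQ R))]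
    (hp : 0 < p) (h4 : 4 * q < p ^ 2) (hD : ∀ r : ℚ, r ^ 2 ≠ (p : ℚ) ^ 2 - 4 * q)
    (ℓ : ℕ) (hℓ : ℓ.Prime) (hq : q = ℓ) (n : ℤ) (hn : ∀ s : ZMod ℓ, s ^ 2 ≠ (n : ZMod ℓ))
    (u : (realField R)ˣ) (hu : (u : realField R) = AdjoinRoot.of (realPolyQ R) n) :
    (QuotientGroup.mk u : cmNormResidueGroup R) ≠ splitDiscriminantClassCM R 2 := by
  haveI : Fact ℓ.Prime := ⟨hℓ⟩
  haveI : Fact (Irreducible (cmPolyQ R)) := fact_irreducible_cmPolyQ_of_pos hR hp h4 hD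
  subst hq
  exact mk_ne_splitDiscriminantClassCM_of_dvd_step hR 0 ℓ (by ring) n
    (dvd_step_of_ramified_nonsq p ℓ hℓ n hn) u hu

/-- **Non-split criterion at the ramified degree-one prime `(σ)`, classes `[ℓw]`.** Same setting, `q = ℓ` prime,
`p·w` a non-square mod `ℓ`: `[ℓw] ≠ [1]`. (For `E = ℚ(√-(3+√2))`: `[7]`, `[14]`, `[28]` — `6w` a non-square mod `7`
for `w = 1, 2, 4`; while `[21] = [1]`.) [cite: Deligne1982HodgeCycles, §4 p. 30 (1) and Cor. 4.2]
[cite: Landherr1936HermitianForms] -/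
theorem mk_prime_mul_ne_splitDiscriminantClassCM_of_ramified {p q : ℤ} {R : Polynomial ℤ}
    (hR : R = X ^ 2 + C p * X + C q) [Fact (Irreducible (realPolyQ R))]
    (hp : 0 < p) (h4 : 4 * q < p ^ 2) (hD : ∀ r : ℚ, r ^ 2 ≠ (p : ℚ) ^ 2 - 4 * q)
    (ℓ : ℕ) (hℓ : ℓ.Prime) (hq : q = ℓ) (w : ℤ) (hw : ∀ s : ZMod ℓ, s ^ 2 ≠ (p : ZMod ℓ) * (w : ZMod ℓ))
    (u : (realField R)ˣ) (hu : (u : realField R) = AdjoinRoot.of (realPolyQ R) (ℓ * w)) :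
    (QuotientGroup.mk u : cmNormResidueGroup R) ≠ splitDiscriminantClassCM R 2 := by
  haveI : Fact ℓ.Prime := ⟨hℓ⟩
  haveI : Fact (Irreducible (cmPolyQ R)) := fact_irreducible_cmPolyQ_of_pos hR hp h4 hD
  subst hq
  refine mk_ne_splitDiscriminantClassCM_of_dvd_step hR 0 ℓ (by ring) (ℓ * w) ?_ u (by rw [hu]; push_cast; ring_nf)
  intro A B C D M₀ M₁ hX hY
  exact dvd_step_of_ramified_mul p ℓ hℓ w hw A B C D M₀ M₁ (by linear_combination hX) (by linear_combination hY)

/-- **Non-split criterion at a principal degree-one prime `π = t + σ` inert in `E/F`.** For `R = S² + pS + q`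
in the CM regime, `t² - pt + q = ℓ` prime with `-t` a non-square and `2t - p ≢ 0` mod `ℓ`, and `ℓ ∤ w`:
`[ℓw] ≠ [1]` in `F^×/Nm_{E/F}(E^×)` — the obstruction sits at the ONE place `(t + σ)` over `ℓ`, whatever the
conjugate place does. (For `E = ℚ(√-(3+√2))`: `t = 8`, `ℓ = 23`, the census class `[23]` with
`T = {(√2), (23, √2-5)}`; the conjugate place `(23, √2+5)` splits in `E/F`.) [cite: Deligne1982HodgeCycles, §4 p. 30 (1) and Cor. 4.2]
[cite: Landherr1936HermitianForms] -/
theorem mk_prime_mul_ne_splitDiscriminantClassCM_of_inert_degreeOne {p q : ℤ} {R : Polynomial ℤ}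
    (hR : R = X ^ 2 + C p * X + C q) [Fact (Irreducible (realPolyQ R))]
    (hp : 0 < p) (h4 : 4 * q < p ^ 2) (hD : ∀ r : ℚ, r ^ 2 ≠ (p : ℚ) ^ 2 - 4 * q)
    (t : ℤ) (ℓ : ℕ) (hℓ : ℓ.Prime) (hL : t ^ 2 - p * t + q = ℓ)
    (ht : ∀ s : ZMod ℓ, s ^ 2 ≠ -(t : ZMod ℓ)) (h2t : 2 * (t : ZMod ℓ) - (p : ZMod ℓ) ≠ 0)
    (w : ℤ) (hw : ¬ (ℓ : ℤ) ∣ w) (u : (realField R)ˣ)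
    (hu : (u : realField R) = AdjoinRoot.of (realPolyQ R) (ℓ * w)) :
    (QuotientGroup.mk u : cmNormResidueGroup R) ≠ splitDiscriminantClassCM R 2 := by
  haveI : Fact ℓ.Prime := ⟨hℓ⟩
  haveI : Fact (Irreducible (cmPolyQ R)) := fact_irreducible_cmPolyQ_of_pos hR hp h4 hD
  exact mk_ne_splitDiscriminantClassCM_of_dvd_step hR t ℓ hL (ℓ * w)
    (dvd_step_of_inert_degreeOne p q t ℓ hℓ hL ht h2t w hw) u (by rw [hu]; push_cast; ring_nf)

end Summit.HodgeConjecture.HodgeConjecture.Ring2.WeilCoverageCM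

end
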